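import Summits.RiemannHypothesis.RiemannHypothesis.Theorems.SignConeGradedFamilyDefs
import Summits.RiemannHypothesis.RiemannHypothesis.Theorems.SignConeSignConeInequalityCriterion
import Summits.RiemannHypothesis.RiemannHypothesis.Theorems.SignConeSignConeOscillatoryStatus
import Summits.RiemannHypothesis.RiemannHypothesis.Theorems.SignConeSignConeOscillatoryUpToFourFifths
import Summits.RiemannHypothesis.RiemannHypothesis.Theorems.SignConeSignConeOscillatoryUpToOne
import Summits.RiemannHypothesis.RiemannHypothesis.Theorems.SignConeSignConeOscillatoryUpToThirteenTenths
import Summits.RiemannHypothesis.RiemannHypothesis.Theorems.SignConeSignConeOscillatoryUpToSevenFifths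
import Summits.RiemannHypothesis.RiemannHypothesis.Theorems.SignConeSignConeOscillatoryUpToThreeHalves
import Summits.RiemannHypothesis.RiemannHypothesis.Theorems.SignConeCondRungPlattTrudgian
import Summits.RiemannHypothesis.RiemannHypothesis.Theorems.SignConeCondRungPlattTrudgianTwo
import Summits.RiemannHypothesis.RiemannHypothesis.Theorems.SignConeSignConeFarField

/-!
# The graded families of the sign-cone criterion — the LATTICE (antitone / `X_∞ = X` / domination / landed rungs)
(cell `SignConeInequality`, item stmt-RiemannHypothesis-16301; lead-of-record file; vocabulary
`Theorems/SignConeGapRungDefs.lean` (rung-b) + `Theorems/SignConeGradedFamilyDefs.lean`; rung list `Cruxes/SignConeInequality/RUNGS.md`)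

`X := SignConeInequality` is RH (`signConeInequality_iff_riemannHypothesis`, banked). Its truncation ladders, kernel-checked:

* **L1 cutoff** `CutoffRung T`: antitone (`cutoffRung_anti`), `X ↔ ∀ T, CutoffRung T` (`signConeInequality_iff_forall_cutoffRung`,
  a re-bracketing — no limit piece; the tail above any `T` is `X` again, `forall_gt_signConeAt_iff`), hence
  `RH ↔ ∀ T, CutoffRung T`; LANDED rungs `4/5, 1, 13/10, 7/5, 3/2` unconditionally (pointwise fake-weight certificates) and
  `19/10, 2` on `platt_trudgian_numerical_rh` (Theorem A) — `cutoffRung_*`.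
* **L2 gap count** `GapRung m` (rung-b's definition; `∀ S`-form `gapRung_iff_forall_gapConfinedAt`): antitone; the one genuine
  lemma `signConeAt_of_gapConfinedAt` (FINITE GAP COUNT: at cutoff `a`, `F` vanishes off `[-2a, 2a]` and a far-field negative
  point sits strictly inside a gap `(log n, log (n+1))`, `2 ≤ n ≤ ⌊e^{2a}⌋`, `gap_of_re_neg`), whence `X ↔ ∀ m, GapRung m` and the
  DOMINATION `GapRung m → CutoffRung T` for `⌊e^{2T}⌋ ≤ m + 1` (`cutoffRung_of_gapRung`; e.g. `GapRung 53 → CutoffRung 2`);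
  `GapRung 0 ↔ SignConeFarField` (closed item, so `gapRung_zero`); `GapRung 1 ↔ ∀ n₀ ≥ 2, ∀ a > 0, SingleGapAt n₀ a`
  (`gapRung_one_iff_forall_singleGapAt`, the registered form); induction interface `gapRung_succ_of`.
* shadows `NearCleanRung t₀` / `FarConfinedRung s`: in `Theorems/SignConeGradedFamilyShadows.lean`.

No rung below the wall carries zero information (W-EFFMAG); these are record/calibration theorems (DECOMPOSITION-r2 §R2.4).
-/

noncomputable section

-- `Summit.RiemannHypothesis.RiemannHypothesis.…` repeats a namespace component by design (D-0017 layout).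
set_option linter.dupNamespace false

open scoped BigOperators ComplexConjugate
open Complex MeasureTheory Set Filter

namespace Summit.RiemannHypothesis.RiemannHypothesis.Theorems.SignCone

open Literature.NumberTheory.LFunctions
open Summit.RiemannHypothesis.RiemannHypothesis.Theses.SignCone
open Summit.RiemannHypothesis.RiemannHypothesis.Theorems.SignConeFarField (SignConeFarField_of)

/-! ## `X = ∀ a > 0, X_a`; monotonicity in the cutoff -/

/-- `SignConeInequality` is literally `∀ a > 0, SignConeAt a`. [folklore] -/
theorem signConeInequality_iff_forall_signConeAt : SignConeInequality ↔ ∀ a : ℝ, 0 < a → SignConeAt a :=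
  Iff.rfl

/-- **Antitone in the cutoff**: a family supported in `[-a, a]` is supported in `[-A, A]` for `a ≤ A`,
so `X_A → X_a`. [folklore] -/
theorem signConeAt_anti {a A : ℝ} (h : a ≤ A) (hA : SignConeAt A) : SignConeAt a := by
  intro k g hg
  exact hA k g (fun i => ⟨(hg i).1, (hg i).2.trans (Set.Icc_subset_Icc (by linarith) h)⟩)

/-! ## L1 — the cutoff ladder -/

/-- The cutoff ladder is antitone: a higher rung implies every lower one. [folklore] -/
theorem cutoffRung_anti {T T' : ℝ} (h : T ≤ T') (hT' : CutoffRung T') : CutoffRung T :=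
  fun a ha haT => hT' a ha (haT.trans h)

/-- By monotonicity a rung is `X_a` at its top cutoff (for `T > 0`). [folklore] -/
theorem cutoffRung_iff_signConeAt {T : ℝ} (hT : 0 < T) : CutoffRung T ↔ SignConeAt T :=
  ⟨fun h => h T hT le_rfl, fun h _a _ha haT => signConeAt_anti haT h⟩

/-- **`X_∞ = X` for L1**: the crux is the conjunction of all cutoff rungs (a re-bracketing; there is no
limit-interchange piece). [folklore] -/
theorem signConeInequality_iff_forall_cutoffRung : SignConeInequality ↔ ∀ T : ℝ, CutoffRung T :=
  ⟨fun h _T a ha _ => h a ha, fun h a ha => h a a ha le_rfl⟩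

/-- The tail above any `T ≥ 0` is the crux again (why no finite cutoff split qualifies as a decomposition:
BC2 (c) fails for the tail piece). [folklore] -/
theorem forall_gt_signConeAt_iff {T : ℝ} (hT : 0 ≤ T) :
    (∀ a : ℝ, T < a → SignConeAt a) ↔ SignConeInequality := by
  refine ⟨fun h a ha => ?_, fun h a ha => h a (hT.trans_lt ha)⟩
  have hlt : T < max a (T + 1) := lt_of_lt_of_le (by linarith) (le_max_right _ _)
  exact signConeAt_anti (le_max_left a (T + 1)) (h _ hlt)

/-! ### Landed rungs of L1 (unconditional: pointwise fake-weight certificates; conditional: Theorem A on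
`platt_trudgian_numerical_rh`) -/

/-- Rung `4/5` (no fake primes, `signConeInequality_upTo_four_fifths`). [folklore] -/
theorem cutoffRung_four_fifths : CutoffRung (4 / 5) :=
  fun a ha h => signConeInequality_upTo_four_fifths a ha h

/-- Rung `1` (pwCert1, fake primes on `{2,3,4,5,7}`; `signConeInequality_upTo_one`). [folklore] -/
theorem cutoffRung_one : CutoffRung 1 :=
  fun a ha h => signConeInequality_upTo_one a ha h

/-- Rung `13/10` (pwCert13s; `signConeInequality_upTo_thirteen_tenths`). [folklore] -/
theorem cutoffRung_thirteen_tenths : CutoffRung (13 / 10) :=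
  fun a ha h => signConeInequality_upTo_thirteen_tenths a ha h

/-- Rung `7/5` (pwCert75; `signConeInequality_upTo_seven_fifths`, p157786). [folklore] -/
theorem cutoffRung_seven_fifths : CutoffRung (7 / 5) :=
  fun a ha h => signConeInequality_upTo_seven_fifths a ha h

/-- **Rung `3/2`, the current unconditional record** (pwCert32: 17 fake nodes `3..19`, Dirichlet-SOS tail;
`signConeInequality_upTo_three_halves`, landed 2026-08-17T14:18Z). [folklore] -/
theorem cutoffRung_three_halves : CutoffRung (3 / 2) :=
  fun a ha h => signConeInequality_upTo_three_halves a ha h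

/-- Rung `19/10` conditionally on `platt_trudgian_numerical_rh` (Theorem A, honest weights `n ≤ 46`, no SOS;
`signConeInequality_upTo_nineteen_tenths_of_plattTrudgian`, p156051). [cite: PlattTrudgianBLMS2021, Theorem 1] -/
theorem cutoffRung_nineteen_tenths_of_plattTrudgian (hPT : platt_trudgian_numerical_rh) : CutoffRung (19 / 10) :=
  fun a ha h => signConeInequality_upTo_nineteen_tenths_of_plattTrudgian hPT a ha h

/-- **Rung `2`, the current conditional record** (Theorem A + SOS comb `crSOS55` on `platt_trudgian_numerical_rh`;
`signConeInequality_upTo_two_of_plattTrudgian`, p156847). [cite: PlattTrudgianBLMS2021, Theorem 1] -/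
theorem cutoffRung_two_of_plattTrudgian (hPT : platt_trudgian_numerical_rh) : CutoffRung 2 :=
  fun a ha h => signConeInequality_upTo_two_of_plattTrudgian hPT a ha h

/-- Every rung under RH (`signConeInequality_of_riemannHypothesis`, p128354). [folklore] -/
theorem cutoffRung_of_riemannHypothesis (hRH : _root_.Summit.RiemannHypothesis) (T : ℝ) : CutoffRung T :=
  fun a ha _ => signConeInequality_of_riemannHypothesis hRH a ha

/-- **The top of L1 is the summit** (banked criterion `signConeInequality_iff_riemannHypothesis`, p161538):
`RH ↔ ∀ T, CutoffRung T`. [folklore] -/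
theorem riemannHypothesis_iff_forall_cutoffRung : _root_.Summit.RiemannHypothesis ↔ ∀ T : ℝ, CutoffRung T :=
  signConeInequality_iff_riemannHypothesis.symm.trans signConeInequality_iff_forall_cutoffRung

/-! ## L2 — the gap-count ladder -/

/-- **The gap-location lemma.** For an autocorrelation sum `F = Σᵢ gᵢ ⋆ g̃ᵢ` that is non-negative at the
nodes, a far-field point `|t| ≥ log 2` with `Re F(t) < 0` lies STRICTLY inside the node gap
`(log n, log (n + 1))` with `n = ⌊e^{|t|}⌋ ≥ 2` (`F` is hermitian, so `Re F(-log n) = Re F(log n) ≥ 0`). [folklore] -/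
theorem gap_of_re_neg {k : ℕ} {g : Fin k → ℝ → ℂ} {F : ℝ → ℂ}
    (hF : F = fun t => ∑ i, weilConv (g i) (weilReflect (g i)) t)
    (hn : ∀ n : ℕ, 2 ≤ n → 0 ≤ (F (Real.log n)).re) {t : ℝ} (ht : Real.log 2 ≤ |t|) (hneg : (F t).re < 0) :
    2 ≤ ⌊Real.exp |t|⌋₊ ∧ Real.log (⌊Real.exp |t|⌋₊ : ℕ) < |t| ∧ |t| < Real.log ((⌊Real.exp |t|⌋₊ : ℕ) + 1) := by
  set n : ℕ := ⌊Real.exp |t|⌋₊ with hn_def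
  have hexp_pos : 0 < Real.exp |t| := Real.exp_pos _
  have h2 : (2 : ℝ) ≤ Real.exp |t| := by
    have := Real.exp_le_exp.2 ht
    rwa [Real.exp_log (by norm_num : (0 : ℝ) < 2)] at this
  have hn2 : 2 ≤ n := Nat.le_floor (by exact_mod_cast h2)
  have hnpos : (0 : ℝ) < n := by exact_mod_cast (lt_of_lt_of_le (by norm_num) hn2)
  have hfloor_le : (n : ℝ) ≤ Real.exp |t| := Nat.floor_le hexp_pos.le
  have hlt_floor : Real.exp |t| < (n : ℝ) + 1 := Nat.lt_floor_add_one _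
  -- `log n ≤ |t| < log (n + 1)`
  have hlog_le : Real.log n ≤ |t| := by
    rw [Real.log_le_iff_le_exp hnpos]
    exact hfloor_le
  have hlog_lt : |t| < Real.log ((n : ℝ) + 1) := by
    rw [Real.lt_log_iff_exp_lt (by linarith)]
    exact hlt_floor
  -- `Re F` is even (`F` hermitian), so `|t|` is not a node
  have hsym : ∀ s : ℝ, (F (-s)).re = (F s).re := by
    intro s
    rw [hF]
    simp only [Complex.re_sum]
    refine Finset.sum_congr rfl (fun i _ => ?_)
    rw [← conj_weilConv_weilReflect_neg (g i) s, Complex.conj_re]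
  have habs : (F |t|).re = (F t).re := by
    rcases abs_choice t with h | h
    · rw [h]
    · rw [h, hsym]
  have hne : Real.log n ≠ |t| := by
    intro h
    have h0 : 0 ≤ (F (Real.log n)).re := hn n hn2
    rw [h, habs] at h0
    linarith
  exact ⟨hn2, lt_of_le_of_ne hlog_le hne, hlog_lt⟩

/-- **Finite gap count at a cutoff**: at cutoff `a`, `F` vanishes off `[-2a, 2a]`, so its far-field
negativity lies in the gaps `n = 2, …, ⌊e^{2a}⌋`; hence the gap-confined statement for that dirty set IS `X_a`. [folklore] -/
theorem signConeAt_of_gapConfinedAt {a : ℝ} (h : GapConfinedAt (Finset.Icc 2 ⌊Real.exp (2 * a)⌋₊) a) :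
    SignConeAt a := by
  intro k g hg F hn
  refine h k g hg hn (fun t ht hneg => ?_)
  have hF : F = fun t => ∑ i, weilConv (g i) (weilReflect (g i)) t := rfl
  obtain ⟨hn2, hlo, hhi⟩ := gap_of_re_neg (g := g) hF hn ht hneg
  refine ⟨⌊Real.exp |t|⌋₊, Finset.mem_Icc.2 ⟨hn2, Nat.floor_le_floor ?_⟩, hlo.le, hhi⟩
  -- `|t| ≤ 2a`, for otherwise `F t = 0`
  refine Real.exp_le_exp.2 (not_lt.1 fun hlt => ?_)
  have h0 : F t = 0 := autocorrSum_eq_zero_of_lt (k := k) g (fun i => (hg i).2) (t := t) hlt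
  have hneg' : (F t).re < 0 := hneg
  rw [h0, Complex.zero_re] at hneg'
  exact lt_irrefl _ hneg'

/-- **`GapRung` in `∀ S`-form**: rung `m` is the gap-confined statement for every dirty set of size `≤ m` at every
cutoff (the `∃ s` of `GapRung` pulled out of the hypothesis). [folklore] -/
theorem gapRung_iff_forall_gapConfinedAt {m : ℕ} :
    GapRung m ↔ ∀ S : Finset ℕ, S.card ≤ m → ∀ a : ℝ, 0 < a → GapConfinedAt S a := by
  constructor
  · intro h S hS a ha k g hg F hn hconf
    exact h a ha k g hg hn ⟨S, hS, hconf⟩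
  · intro h a ha k g hg F hn hex
    obtain ⟨S, hS, hconf⟩ := hex
    exact h S hS a ha k g hg hn hconf

/-- The gap-count ladder is antitone in `m`: allowing more dirty gaps is a larger class. [folklore] -/
theorem gapRung_anti {m m' : ℕ} (h : m ≤ m') (hm' : GapRung m') : GapRung m := by
  rw [gapRung_iff_forall_gapConfinedAt] at hm' ⊢
  exact fun S hS a ha => hm' S (hS.trans h) a ha

/-- Gap confinement is monotone in the dirty set. [folklore] -/
theorem gapConfinedAt_mono {S S' : Finset ℕ} {a : ℝ} (hSS' : S ⊆ S') (h : GapConfinedAt S' a) :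
    GapConfinedAt S a := by
  intro k g hg F hn hconf
  exact h k g hg hn (fun t ht hneg => by
    obtain ⟨n, hnS, hgap⟩ := hconf t ht hneg
    exact ⟨n, hSS' hnS, hgap⟩)

/-- Every rung of L2 is implied by the crux (drop the confinement hypothesis). [folklore] -/
theorem gapRung_of_signConeInequality (h : SignConeInequality) (m : ℕ) : GapRung m :=
  fun a ha k g hg hn _hconf => h a ha k g hg hn

/-- **Domination of L1 by L2**: `GapRung m → CutoffRung T` as soon as the cutoff window `[log 2, 2T]` meets at
most `m` gaps, i.e. `⌊e^{2T}⌋ ≤ m + 1` (e.g. `GapRung 53 → CutoffRung 2`, `e⁴ = 54.6`). [folklore] -/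
theorem cutoffRung_of_gapRung {T : ℝ} {m : ℕ} (hTm : ⌊Real.exp (2 * T)⌋₊ ≤ m + 1) (hm : GapRung m) :
    CutoffRung T := by
  intro a ha haT
  refine signConeAt_of_gapConfinedAt (gapRung_iff_forall_gapConfinedAt.1 hm _ ?_ a ha)
  rw [Nat.card_Icc]
  have : ⌊Real.exp (2 * a)⌋₊ ≤ ⌊Real.exp (2 * T)⌋₊ :=
    Nat.floor_le_floor (Real.exp_le_exp.2 (by linarith))
  omega

/-- The same with a real-inequality side condition: `e^{2T} < m + 2` suffices. [folklore] -/
theorem cutoffRung_of_gapRung' {T : ℝ} {m : ℕ} (hTm : Real.exp (2 * T) < m + 2) (hm : GapRung m) :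
    CutoffRung T := by
  refine cutoffRung_of_gapRung (Nat.le_of_lt_succ ?_) hm
  exact (Nat.floor_lt (Real.exp_pos _).le).2 (by exact_mod_cast hTm)

/-- **`X_∞ = X` for L2** (a genuine lemma: finite gap count from `supp F ⊆ [-2a, 2a]`). [folklore] -/
theorem signConeInequality_iff_forall_gapRung : SignConeInequality ↔ ∀ m : ℕ, GapRung m :=
  ⟨gapRung_of_signConeInequality, fun h a ha =>
    signConeAt_of_gapConfinedAt
      (gapRung_iff_forall_gapConfinedAt.1 (h _) (Finset.Icc 2 ⌊Real.exp (2 * a)⌋₊) le_rfl a ha)⟩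

/-- **The bottom rung of L2 is the CLOSED far-field item**: `GapRung 0 ↔ SignConeFarField`
(stmt-RiemannHypothesis-16305, margin `-0.763 > -1`). [folklore] -/
theorem gapRung_zero_iff_signConeFarField : GapRung 0 ↔ SignConeFarField := by
  rw [gapRung_iff_forall_gapConfinedAt]
  constructor
  · intro h a ha k g hg F hn hff
    have hS : (∅ : Finset ℕ).card ≤ 0 := by simp
    exact h ∅ hS a ha k g hg hn (fun t ht hneg => absurd (hff t ht) (not_le.2 hneg))
  · intro h S hS a ha k g hg F hn hconf
    have hS0 : S = ∅ := Finset.card_eq_zero.1 (Nat.le_zero.1 hS)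
    refine h a ha k g hg hn (fun t ht => not_lt.1 fun hneg => ?_)
    obtain ⟨n, hn', _⟩ := hconf t ht hneg
    rw [hS0] at hn'
    exact absurd hn' (Finset.notMem_empty n)

/-- Hence `GapRung 0` holds (`SignConeFarField_of`, landed). [folklore] -/
theorem gapRung_zero : GapRung 0 :=
  gapRung_zero_iff_signConeFarField.2 SignConeFarField_of

/-- A single-gap statement is the gap-confined statement for the singleton dirty set. [folklore] -/
theorem singleGapAt_iff_gapConfinedAt_singleton {n₀ : ℕ} {a : ℝ} :
    SingleGapAt n₀ a ↔ GapConfinedAt {n₀} a := by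
  constructor
  · intro h k g hg F hn hconf
    exact h k g hg hn (fun t ht hneg => by
      obtain ⟨n, hn', hgap⟩ := hconf t ht hneg
      rw [Finset.mem_singleton] at hn'
      subst hn'
      exact hgap)
  · intro h k g hg F hn hconf
    exact h k g hg hn (fun t ht hneg => ⟨n₀, Finset.mem_singleton_self _, hconf t ht hneg⟩)

/-- A far-field-clean test (no far negativity at all) lies in every single-gap class; so the single-gap
statement at ANY `n₀` gives the far-field conclusion. [folklore] -/
theorem gapConfinedAt_empty_of_singleGapAt {n₀ : ℕ} {a : ℝ} (h : SingleGapAt n₀ a) :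
    GapConfinedAt ∅ a := by
  intro k g hg F hn hconf
  exact h k g hg hn (fun t ht hneg => by
    obtain ⟨n, hn', _⟩ := hconf t ht hneg
    exact absurd hn' (Finset.notMem_empty n))

/-- Dirty "gaps" below the first node carry nothing: for `n ≤ 1` the interval `(log n, log (n+1))` misses the
far field, so confinement to `S` is confinement to `S` with `0, 1` erased. [folklore] -/
theorem gapConfinedAt_of_erase_lt_two {S : Finset ℕ} {a : ℝ}
    (h : GapConfinedAt (S.filter (fun n => 2 ≤ n)) a) : GapConfinedAt S a := by
  intro k g hg F hn hconf
  refine h k g hg hn (fun t ht hneg => ?_)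
  obtain ⟨n, hnS, hlo, hhi⟩ := hconf t ht hneg
  refine ⟨n, Finset.mem_filter.2 ⟨hnS, ?_⟩, hlo, hhi⟩
  by_contra hlt
  -- `n ≤ 1`: then `log (n + 1) ≤ log 2 ≤ |t|`, contradiction
  have hn1 : (n : ℝ) + 1 ≤ 2 := by
    have hle : n ≤ 1 := by omega
    have : (n : ℝ) ≤ 1 := by exact_mod_cast hle
    linarith
  have : Real.log ((n : ℝ) + 1) ≤ Real.log 2 :=
    Real.log_le_log (by positivity) hn1
  linarith

/-- **`GapRung 1` is the single-gap statement at every gap `n₀ ≥ 2` and every cutoff** — the form in which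
the rung is registered on the item (stubs `stub_gap_small` / `stub_gap_mid` / `stub_gap_large`). [folklore] -/
theorem gapRung_one_iff_forall_singleGapAt :
    GapRung 1 ↔ ∀ n₀ : ℕ, 2 ≤ n₀ → ∀ a : ℝ, 0 < a → SingleGapAt n₀ a := by
  rw [gapRung_iff_forall_gapConfinedAt]
  constructor
  · intro h n₀ _hn₀ a ha
    exact singleGapAt_iff_gapConfinedAt_singleton.2 (h {n₀} (by simp) a ha)
  · intro h S hS a ha
    refine gapConfinedAt_of_erase_lt_two ?_
    set S' := S.filter (fun n => 2 ≤ n) with hS'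
    have hS'card : S'.card ≤ 1 := (Finset.card_filter_le _ _).trans hS
    rcases Nat.le_one_iff_eq_zero_or_eq_one.1 hS'card with h0 | h1
    · rw [Finset.card_eq_zero.1 h0]
      exact gapConfinedAt_empty_of_singleGapAt (h 2 le_rfl a ha)
    · obtain ⟨n₀, hn₀⟩ := Finset.card_eq_one.1 h1
      have hn₀mem : n₀ ∈ S' := by rw [hn₀]; exact Finset.mem_singleton_self _
      have hn₀2 : 2 ≤ n₀ := (Finset.mem_filter.1 hn₀mem).2
      rw [hn₀]
      exact singleGapAt_iff_gapConfinedAt_singleton.1 (h n₀ hn₀2 a ha)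

/-- `GapRung (m + 1)` from `GapRung m`-style data: it suffices to treat dirty sets of EXACTLY the new
cardinality made of gaps `n ≥ 2` (the rest is monotonicity) — the induction interface for "push `m`". [folklore] -/
theorem gapRung_succ_of {m : ℕ} (hm : GapRung m)
    (hnew : ∀ S : Finset ℕ, S.card = m + 1 → (∀ n ∈ S, 2 ≤ n) → ∀ a : ℝ, 0 < a → GapConfinedAt S a) :
    GapRung (m + 1) := by
  rw [gapRung_iff_forall_gapConfinedAt] at hm ⊢
  intro S hS a ha
  refine gapConfinedAt_of_erase_lt_two ?_
  set S' := S.filter (fun n => 2 ≤ n) with hS'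
  have hS'card : S'.card ≤ m + 1 := (Finset.card_filter_le _ _).trans hS
  rcases Nat.lt_or_ge S'.card (m + 1) with hlt | hge
  · exact hm S' (Nat.lt_succ_iff.1 hlt) a ha
  · exact hnew S' (le_antisymm hS'card hge) (fun n hn => (Finset.mem_filter.1 hn).2) a ha

/-- Under RH every rung of L2 holds (through the crux). [folklore] -/
theorem gapRung_of_riemannHypothesis (hRH : _root_.Summit.RiemannHypothesis) (m : ℕ) : GapRung m :=
  gapRung_of_signConeInequality (signConeInequality_iff_riemannHypothesis.2 hRH) m


end Summit.RiemannHypothesis.RiemannHypothesis.Theorems.SignCone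

end
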